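import Literature.NumberTheory.EllipticCurves.BinaryQuarticPadicTubes
import Literature.MeasureTheory.Group.PadicPolynomialChangeOfVariables
import HarnessLib

/-!
# The volume of an orbit tube: `∫_{U_r ∩ A} #Aut_{ℤ_p} dμ_p = |1/27|_p (1 − p⁻²) · vol((I,J)(A ∩ S_r))`
# (Bhargava–Shankar's `p`-adic change of measure, Props. 3.11–3.12, on one tube)

Companion (auxiliary definitions `levelSubgroup`, `mult`, `splitIndex`, `splitEquiv`; theorems; no named
facts) of
`BinaryQuarticPadicTubes.lean`
(orbit tubes `U_r = GL₂(ℤ_p) · S_r`, the chart image `W_r = Ψ(chartBox r) = K_r · S_r`, the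
invariant box `B = (I,J)(S_r)`), using the `p`-adic change-of-variables theorems of
`Literature/MeasureTheory/Group/PadicPolynomialChangeOfVariables.lean` (for an étale polynomial
system `F` and a small ball `B₀`: `vol(F(A ∩ B₀)) = |det J_F|_p vol(A ∩ B₀)`), the measure
invariance of the action (`BinaryQuarticIntegralAction.lean`) and the index
`[GL₂(ℤ_p) : ℤ_pˣ K_r] = p^{3r−2}(p² − 1)` (`Literature/GroupTheory/Index/PadicGL2Congruence.lean`).

Source. M. Bhargava, A. Shankar, Ann. of Math. (2) 181 (2015) 191–242, Props. 3.11–3.12 of the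
published version (Prop. 2.7 "follows from a Jacobian computation" and the proof of Prop. 5.12 of
`arXiv:1006.1002v2`: "`∫_{B_p^F} (1/#Aut(f)) df = |2/27|_p Vol(PGL₂(ℤ_p)) ∫ Σ_{f ∈ B_p^{I,J}} 1/#Aut(f)`,
… the volume of `PGL₂(ℤ_p)` … is `(1 − 1/p²)`"). On a single orbit tube the printed identity reads,
for every `GL₂(ℤ_p)`-invariant measurable `A ⊆ U_r`:

  `∫⁻_{A} #Aut_{ℤ_p}(f) dμ_p(f) = |1/27|_p · (1 − p⁻²) · vol₂((I,J)(A ∩ S_r))`,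

the fibres of `(I, J)` in `U_r` being single orbits (`mem_orbit_of_invPair_eq`), so that
`(I,J)(A ∩ S_r)` is the set of `(I, J)` whose orbit lies in `A`. Main statement:
`BinaryQuartic.setLIntegral_autCard_tube`. The argument (this file):

* §1 the subgroup `H_r = ℤ_pˣ K_r`, its finitely many cosets, `Stab(s) ∩ H_r = ℤ_pˣ`;
* §2 the multiplicity function `N(f) = #{tH_r : f ∈ t • W_r}`: `N = #Aut_{ℤ_p}` on `U_r`,
  `∫⁻_A N = [G : H_r] μ_p(A ∩ W_r)`;
* §3 `μ_p(A ∩ W_r) = |det J_Ψ|_p vol₅(chartBox ∩ Ψ̃⁻¹A)` (change of variables for `Ψ`);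
* §4 `chartBox ∩ Ψ̃⁻¹ A = chartBox ∩ Φ⁻¹(ℤ_p³ × (I,J)(A ∩ S_r))` and
  `|m|_p vol₅(…) = p^{−3r} vol₂((I,J)(A ∩ S_r))` (change of variables for `Φ`, the shear, and the
  product structure `ℤ_p⁵ = ℤ_p³ × ℤ_p²`);
* §5 the constants: `[G:H_r] · |det J_Ψ|/|m| · p^{−3r} = |1/27|_p (1 − p⁻²)`.

## References

* M. Bhargava, A. Shankar, Ann. of Math. (2) 181 (2015) 191–242, Props. 3.11–3.12, Cor. 3.8 of the
  published version; Prop. 2.7 and the proof of Prop. 5.12 of arXiv:1006.1002v2.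
  [cite: BhargavaShankarAnnals2015, Prop. 5.12 proof (Jacobian change of variables; arXiv:1006.1002v2 numbering)]
-/

noncomputable section

open scoped Classical Pointwise ENNReal NNReal
open Matrix MulAction Set Metric MvPolynomial MeasureTheory Literature.GroupTheory.Index

namespace Literature.NumberTheory.EllipticCurves

namespace BinaryQuartic

open scoped IntegralAction

variable {p : ℕ} [Fact p.Prime]

local notation "G" => GL (Fin 2) ℤ_[p]

/-! ## §1 The subgroup `H_r = ℤ_pˣ · K_r` -/

/-- Elements of `ℤ_pˣ K_r` are products `z k`. [folklore] -/
theorem exists_scalar_mul_of_mem_sup {r : ℕ} {h : G} (hh : h ∈ GL2.scalarSubgroup ⊔ GL2.congruenceSubgroup (p := p) r) :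
    ∃ z ∈ GL2.scalarSubgroup (p := p), ∃ k ∈ GL2.congruenceSubgroup (p := p) r, h = z * k := by
  have : (h : G) ∈ ((GL2.scalarSubgroup ⊔ GL2.congruenceSubgroup (p := p) r : Subgroup G) : Set G) := hh
  rw [Subgroup.mul_normal] at this
  obtain ⟨z, hz, k, hk, rfl⟩ := this
  exact ⟨z, hz, k, hk, rfl⟩

/-- **`Stab(s) ∩ ℤ_pˣK_r = ℤ_pˣ`** for `Δ(s) ≠ 0` and `pʳ ∤ 2`. [folklore] -/
theorem stabilizer_inf_scalar_sup_congruence {s : BinaryQuartic ℤ_[p]} (hΔ : s.disc ≠ 0) {r : ℕ}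
    (h2 : ¬ (p : ℤ_[p]) ^ r ∣ 2) :
    stabilizer G s ⊓ (GL2.scalarSubgroup ⊔ GL2.congruenceSubgroup (p := p) r) = GL2.scalarSubgroup := by
  refine le_antisymm ?_ (le_inf (scalarSubgroup_le_stabilizer s) le_sup_left)
  intro g hg
  obtain ⟨hgs, hgH⟩ := Subgroup.mem_inf.mp hg
  obtain ⟨z, hz, k, hk, rfl⟩ := exists_scalar_mul_of_mem_sup hgH
  have hkstab : k ∈ stabilizer G s := by
    have hz' : z ∈ stabilizer G s := scalarSubgroup_le_stabilizer s hz
    simpa using (stabilizer G s).mul_mem ((stabilizer G s).inv_mem hz') hgs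
  have hk' : k ∈ stabilizer G s ⊓ GL2.congruenceSubgroup r := Subgroup.mem_inf.mpr ⟨hkstab, hk⟩
  rw [stabilizer_inf_congruenceSubgroup hΔ h2] at hk'
  exact GL2.scalarSubgroup.mul_mem hz (Subgroup.mem_inf.mp hk').1

/-- `#Aut_{ℤ_p}` is a class function: `autCard (g • f) = autCard f`. [folklore] -/
theorem autCard_smul (g : G) (f : BinaryQuartic ℤ_[p]) : autCard (g • f) = autCard f := by
  rw [autCard, autCard, stabilizer_smul_eq_stabilizer_map_conj]
  have hZ : (GL2.scalarSubgroup (p := p)).map (MulAut.conj g).toMonoidHom = GL2.scalarSubgroup := by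
    ext z
    constructor
    · rintro ⟨z', hz', rfl⟩
      obtain ⟨c, rfl⟩ := hz'
      refine ⟨c, Units.ext ?_⟩
      simp only [MulEquiv.coe_toMonoidHom, MulAut.conj_apply, Units.val_mul, GL2.coe_scalar]
      rw [Matrix.mul_smul, Matrix.mul_one, Matrix.smul_mul, ← Units.val_mul, mul_inv_cancel, Units.val_one]
    · intro hz
      obtain ⟨c, rfl⟩ := hz
      refine ⟨Units.map (Matrix.scalar (Fin 2)).toMonoidHom c, ⟨c, rfl⟩, Units.ext ?_⟩
      simp only [MulEquiv.coe_toMonoidHom, MulAut.conj_apply, Units.val_mul, GL2.coe_scalar]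
      rw [Matrix.mul_smul, Matrix.mul_one, Matrix.smul_mul, ← Units.val_mul, mul_inv_cancel, Units.val_one]
  conv_rhs => rw [← Subgroup.relIndex_map_map_of_injective (f := (MulAut.conj g).toMonoidHom)
    GL2.scalarSubgroup (stabilizer G f) (MulAut.conj g).injective]
  rw [hZ]

/-! ## §2 The subgroup `H_r`, translates of `W_r`, the multiplicity function -/

/-- `H_r = ℤ_pˣ · K_r ≤ GL₂(ℤ_p)` (scalars times the principal congruence subgroup; its cosets are
the points of `PGL₂(ℤ/pʳℤ)`). [folklore] -/
def levelSubgroup (r : ℕ) : Subgroup G := GL2.scalarSubgroup ⊔ GL2.congruenceSubgroup (p := p) r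

/-- `H_r` has finite index `p^{3r−2}(p² − 1)` (`r ≥ 1`). [folklore] -/
theorem index_levelSubgroup {r : ℕ} (hr : 1 ≤ r) : (levelSubgroup (p := p) r).index = p ^ (3 * r - 2) * (p ^ 2 - 1) :=
  GL2.index_scalar_sup_congruenceSubgroup hr

/-- `H_r` has finite index. [folklore] -/
instance finiteIndex_levelSubgroup (r : ℕ) : (levelSubgroup (p := p) r).FiniteIndex :=
  inferInstanceAs (GL2.scalarSubgroup ⊔ GL2.congruenceSubgroup (p := p) r).FiniteIndex

/-- `G ⧸ H_r` is finite. [folklore] -/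
instance finite_quotient_levelSubgroup (r : ℕ) : Finite (G ⧸ levelSubgroup (p := p) r) :=
  Subgroup.finite_quotient_of_finiteIndex

/-- A (noncomputable) enumeration of `G ⧸ H_r`, fixed once and for all. [folklore] -/
instance fintype_quotient_levelSubgroup (r : ℕ) : Fintype (G ⧸ levelSubgroup (p := p) r) :=
  Fintype.ofFinite _

/-- `Stab(s) ∩ H_r = ℤ_pˣ` in terms of `levelSubgroup`. [folklore] -/
theorem stabilizer_inf_levelSubgroup {s : BinaryQuartic ℤ_[p]} (hΔ : s.disc ≠ 0) {r : ℕ}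
    (h2 : ¬ (p : ℤ_[p]) ^ r ∣ 2) : stabilizer G s ⊓ levelSubgroup (p := p) r = GL2.scalarSubgroup :=
  stabilizer_inf_scalar_sup_congruence hΔ h2

/-- Hence **`#Aut_{ℤ_p}(s) = [Stab(s) : Stab(s) ∩ H_r]`**, the relative index of `H_r` in `Stab(s)`.
[folklore] -/
theorem autCard_eq_relIndex {s : BinaryQuartic ℤ_[p]} (hΔ : s.disc ≠ 0) {r : ℕ} (h2 : ¬ (p : ℤ_[p]) ^ r ∣ 2) :
    autCard s = (levelSubgroup (p := p) r).relIndex (stabilizer G s) := by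
  rw [autCard, ← Subgroup.inf_relIndex_right (levelSubgroup (p := p) r), inf_comm, stabilizer_inf_levelSubgroup hΔ h2]

/-- `V_{ℤ_p}` is Hausdorff (the coefficient map is an embedding into `ℤ_p⁵`). [folklore] -/
instance instT2Space : T2Space (BinaryQuartic ℤ_[p]) :=
  (Topology.IsEmbedding.mk isInducing_coeffs coeffs_injective).t2Space

/-- **`W_r` is stable under `H_r`**: `h • W_r = W_r` for `h ∈ H_r` (`r ≥ 1`). [folklore] -/
theorem smul_chartImage_eq {f₁ w : BinaryQuartic ℤ_[p]} {r : ℕ} (hr : 1 ≤ r) {h : G} (hh : h ∈ levelSubgroup (p := p) r) :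
    h • chartImage f₁ w r = chartImage f₁ w r := by
  obtain ⟨z, hz, k, hk, rfl⟩ := exists_scalar_mul_of_mem_sup hh
  apply le_antisymm
  · rintro _ ⟨x, hx, rfl⟩
    show (z * k) • x ∈ _
    rw [mul_smul]
    exact smul_mem_chartImage_of_mem_scalarSubgroup hz (smul_mem_chartImage hr hk hx)
  · intro x hx
    refine ⟨(z * k)⁻¹ • x, ?_, smul_inv_smul _ _⟩
    rw [_root_.mul_inv_rev, mul_smul]
    exact smul_mem_chartImage hr ((GL2.congruenceSubgroup r).inv_mem hk)
      (smul_mem_chartImage_of_mem_scalarSubgroup (GL2.scalarSubgroup.inv_mem hz) hx)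

/-- Hence `(t h) • W_r = t • W_r` for `h ∈ H_r`. [folklore] -/
theorem mul_smul_chartImage_eq {f₁ w : BinaryQuartic ℤ_[p]} {r : ℕ} (hr : 1 ≤ r) (t : G) {h : G}
    (hh : h ∈ levelSubgroup (p := p) r) : (t * h) • chartImage f₁ w r = t • chartImage f₁ w r := by
  rw [mul_smul, smul_chartImage_eq hr hh]

/-- **The multiplicity function** `N(f) = #{t H_r : f ∈ t • W_r}`, the number of translates of the
chart image through `f` (counted on `G ⧸ H_r`, on which `t ↦ t • W_r` is well defined). [folklore] -/
def mult (f₁ w : BinaryQuartic ℤ_[p]) (r : ℕ) (f : BinaryQuartic ℤ_[p]) : ℕ :=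
  Nat.card {q : G ⧸ levelSubgroup (p := p) r // f ∈ q.out • chartImage f₁ w r}

/-- `f ∈ q.out • W_r ↔ f ∈ t • W_r` for any representative `t` of `q`. [folklore] -/
theorem mem_out_smul_iff {f₁ w : BinaryQuartic ℤ_[p]} {r : ℕ} (hr : 1 ≤ r) (t : G) (f : BinaryQuartic ℤ_[p]) :
    f ∈ (Quotient.out (QuotientGroup.mk t : G ⧸ levelSubgroup (p := p) r)) • chartImage f₁ w r ↔
      f ∈ t • chartImage f₁ w r := by
  have h := QuotientGroup.mk_out_eq_mul (levelSubgroup (p := p) r) t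
  obtain ⟨h', hh'⟩ := h
  rw [hh', mul_smul_chartImage_eq hr t h'.2]

/-! ## §3 The multiplicity on the tube: `N = #Aut_{ℤ_p}` -/

/-- For `s ∈ S_r` and `g₀ ∈ G`: `g₀ • s ∈ t • W_r ↔ t ∈ g₀ · Stab(s) · H_r`, i.e. `tH_r = g₀ σ H_r`
for some `σ ∈ Stab(s)`. [folklore] -/
theorem mem_smul_chartImage_iff_exists_stabilizer {f₁ w : BinaryQuartic ℤ_[p]} {r : ℕ} (hr : 1 ≤ r)
    (hm : (p : ℝ) ^ (-(r : ℤ)) < ‖f₁.sliceJac w‖) {s : BinaryQuartic ℤ_[p]} (hs : s ∈ slice f₁ w r) (g₀ t : G) :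
    g₀ • s ∈ t • chartImage f₁ w r ↔
      ∃ σ ∈ stabilizer G s, (QuotientGroup.mk t : G ⧸ levelSubgroup (p := p) r) = QuotientGroup.mk (g₀ * σ) := by
  have key : g₀ • s ∈ t • chartImage f₁ w r ↔ (t⁻¹ * g₀) • s ∈ chartImage f₁ w r := by
    rw [Set.mem_smul_set_iff_inv_smul_mem, ← mul_smul]
  rw [key]
  have hset := setOf_smul_mem_chartImage f₁ w hr hm hs
  have hmem : (t⁻¹ * g₀) • s ∈ chartImage f₁ w r ↔ t⁻¹ * g₀ ∈ (GL2.congruenceSubgroup (p := p) r : Set G) * (stabilizer G s : Set G) := by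
    have := Set.ext_iff.mp hset (t⁻¹ * g₀)
    simpa only [mem_setOf_eq] using this
  rw [hmem, Set.mem_mul]
  constructor
  · rintro ⟨k, hk, σ, hσ, hkσ⟩
    refine ⟨σ⁻¹, (stabilizer G s).inv_mem hσ, ?_⟩
    rw [QuotientGroup.eq]
    -- `t⁻¹ (g₀ σ⁻¹) = k ∈ K_r ≤ H_r`
    have : t⁻¹ * (g₀ * σ⁻¹) = k := by
      rw [← mul_assoc, ← hkσ]; group
    rw [this]
    exact Subgroup.mem_sup_right hk
  · rintro ⟨σ, hσ, hq⟩
    rw [QuotientGroup.eq] at hq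
    -- `t⁻¹ g₀ σ = h ∈ H_r = Z K_r`, so `t⁻¹ g₀ = h σ⁻¹ = (z k) σ⁻¹ = k' (z σ⁻¹)` with `K_r` normal
    obtain ⟨z, hz, k, hk, hzk⟩ := exists_scalar_mul_of_mem_sup hq
    refine ⟨z * k * z⁻¹, ?_, z * σ⁻¹, ?_, ?_⟩
    · exact (GL2.congruenceSubgroup_normal r).conj_mem k hk z
    · exact (stabilizer G s).mul_mem (scalarSubgroup_le_stabilizer s hz) ((stabilizer G s).inv_mem hσ)
    · have : t⁻¹ * g₀ = (t⁻¹ * (g₀ * σ)) * σ⁻¹ := by group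
      rw [this, hzk]; group

/-- The set of cosets `tH_r` with `g₀ • s ∈ t • W_r` is the image of `Stab(s)` under
`σ ↦ g₀ σ H_r`. [folklore] -/
theorem setOf_mem_out_smul_eq_range {f₁ w : BinaryQuartic ℤ_[p]} {r : ℕ} (hr : 1 ≤ r)
    (hm : (p : ℝ) ^ (-(r : ℤ)) < ‖f₁.sliceJac w‖) {s : BinaryQuartic ℤ_[p]} (hs : s ∈ slice f₁ w r) (g₀ : G) :
    {q : G ⧸ levelSubgroup (p := p) r | g₀ • s ∈ q.out • chartImage f₁ w r} =
      Set.range fun σ : stabilizer G s ↦ (QuotientGroup.mk (g₀ * σ) : G ⧸ levelSubgroup (p := p) r) := by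
  ext q
  induction q using QuotientGroup.induction_on with
  | H t =>
    rw [mem_setOf_eq, mem_out_smul_iff hr, mem_smul_chartImage_iff_exists_stabilizer hr hm hs, Set.mem_range]
    constructor
    · rintro ⟨σ, hσ, h⟩; exact ⟨⟨σ, hσ⟩, h.symm⟩
    · rintro ⟨⟨σ, hσ⟩, h⟩; exact ⟨σ, hσ, h.symm⟩

/-- The image of `Stab(s)` in `G ⧸ H_r` has `[Stab(s) : Stab(s) ∩ H_r]` elements. [folklore] -/
theorem natCard_range_mk_mul (H : Subgroup G) (S : Subgroup G) (g₀ : G) :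
    Nat.card (Set.range fun σ : S ↦ (QuotientGroup.mk (g₀ * σ) : G ⧸ H)) = H.relIndex S := by
  rw [Subgroup.relIndex, Subgroup.index]
  -- the map factors through `S ⧸ H.subgroupOf S` injectively
  let φ : S ⧸ H.subgroupOf S → Set.range fun σ : S ↦ (QuotientGroup.mk (g₀ * σ) : G ⧸ H) :=
    Quotient.lift (fun σ : S ↦ ⟨QuotientGroup.mk (g₀ * σ), σ, rfl⟩) (by
      intro σ σ' hσσ'
      apply Subtype.ext
      simp only
      rw [QuotientGroup.eq]
      have h : σ⁻¹ * σ' ∈ H.subgroupOf S := QuotientGroup.leftRel_apply.mp hσσ'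
      rw [Subgroup.mem_subgroupOf] at h
      simpa [mul_assoc] using h)
  refine (Nat.card_congr (Equiv.ofBijective φ ⟨?_, ?_⟩)).symm
  · intro a b hab
    induction a using Quotient.inductionOn with
    | h σ =>
      induction b using Quotient.inductionOn with
      | h σ' =>
        have hab' := congrArg Subtype.val hab
        simp only [φ, Quotient.lift_mk] at hab'
        rw [QuotientGroup.eq] at hab'
        apply Quotient.sound
        refine QuotientGroup.leftRel_apply.mpr ?_
        rw [Subgroup.mem_subgroupOf]
        simpa [mul_assoc] using hab'
  · rintro ⟨_, σ, rfl⟩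
    exact ⟨Quotient.mk _ σ, rfl⟩

/-- **On the tube, `N = #Aut_{ℤ_p}`**: for `f ∈ U_r`, `N(f) = #Aut_{ℤ_p}(f)`
(`r ≥ 1`, `pʳ ∤ 2`, `p⁻ʳ < |m|_p`, `Δ ≠ 0` on the slice). [folklore] -/
theorem mult_eq_autCard {f₁ w : BinaryQuartic ℤ_[p]} {r : ℕ} (hr : 1 ≤ r) (h2 : ¬ (p : ℤ_[p]) ^ r ∣ 2)
    (hm : (p : ℝ) ^ (-(r : ℤ)) < ‖f₁.sliceJac w‖) (hΔ : ∀ s ∈ slice f₁ w r, s.disc ≠ 0)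
    {f : BinaryQuartic ℤ_[p]} (hf : f ∈ tube f₁ w r) : mult f₁ w r f = autCard f := by
  obtain ⟨g₀, s, hs, rfl⟩ := hf
  rw [autCard_smul, mult, autCard_eq_relIndex (hΔ s hs) h2, ← natCard_range_mk_mul (levelSubgroup r) (stabilizer G s) g₀,
    ← setOf_mem_out_smul_eq_range hr hm hs g₀]
  rfl

/-- Off the tube the multiplicity vanishes: `t • W_r ⊆ U_r`. [folklore] -/
theorem mult_eq_zero {f₁ w : BinaryQuartic ℤ_[p]} {r : ℕ} (hr : 1 ≤ r) {f : BinaryQuartic ℤ_[p]}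
    (hf : f ∉ tube f₁ w r) : mult f₁ w r f = 0 := by
  rw [mult, Nat.card_eq_zero]
  left
  refine ⟨fun q ↦ hf ?_⟩
  obtain ⟨x, hx, hxf⟩ := q.2
  rw [← hxf, smul_mem_tube_iff]
  exact chartImage_subset_tube f₁ w hr hx

/-! ## §4 Measurability; the tube is a finite union of translates -/

/-- The orbit chart is continuous. [folklore] -/
theorem continuous_orbitChartForm (f₁ w : BinaryQuartic ℤ_[p]) : Continuous (orbitChartForm f₁ w) := by
  unfold orbitChartForm
  exact (homeomorphFin5 (R := ℤ_[p])).symm.continuous.comp (continuous_pi fun i ↦ MvPolynomial.continuous_eval _)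

/-- The chart box is compact. [folklore] -/
theorem isCompact_chartBox (r : ℕ) : IsCompact (chartBox (p := p) r) :=
  isCompact_closedBall _ _

/-- **`W_r` is compact**, hence measurable. [folklore] -/
theorem isCompact_chartImage (f₁ w : BinaryQuartic ℤ_[p]) (r : ℕ) : IsCompact (chartImage f₁ w r) :=
  (isCompact_chartBox r).image (continuous_orbitChartForm f₁ w)

/-- `t • W_r` is compact. [folklore] -/
theorem isCompact_smul_chartImage (t : G) (f₁ w : BinaryQuartic ℤ_[p]) (r : ℕ) : IsCompact (t • chartImage f₁ w r) :=
  (isCompact_chartImage f₁ w r).image (continuous_glInt_smul t)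

/-- `t • W_r` is measurable. [folklore] -/
theorem measurableSet_smul_chartImage (t : G) (f₁ w : BinaryQuartic ℤ_[p]) (r : ℕ) :
    MeasurableSet (t • chartImage f₁ w r) :=
  (isCompact_smul_chartImage t f₁ w r).isClosed.measurableSet

/-- `W_r` is measurable. [folklore] -/
theorem measurableSet_chartImage (f₁ w : BinaryQuartic ℤ_[p]) (r : ℕ) : MeasurableSet (chartImage f₁ w r) :=
  (isCompact_chartImage f₁ w r).isClosed.measurableSet

/-- **`U_r = ⋃_{tH_r} t • W_r`** (`r ≥ 1`). [folklore] -/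
theorem tube_eq_iUnion {f₁ w : BinaryQuartic ℤ_[p]} {r : ℕ} (hr : 1 ≤ r) :
    tube f₁ w r = ⋃ q : G ⧸ levelSubgroup (p := p) r, q.out • chartImage f₁ w r := by
  apply le_antisymm
  · rintro f ⟨g, s, hs, rfl⟩
    refine Set.mem_iUnion.mpr ⟨QuotientGroup.mk g, ?_⟩
    rw [mem_out_smul_iff hr]
    exact Set.smul_mem_smul_set (slice_subset_chartImage f₁ w hr hs)
  · intro f hf
    obtain ⟨q, hq⟩ := Set.mem_iUnion.mp hf
    obtain ⟨x, hx, rfl⟩ := hq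
    rw [smul_mem_tube_iff]
    exact chartImage_subset_tube f₁ w hr hx

/-- **`U_r` is measurable** (a finite union of compact translates). [folklore] -/
theorem measurableSet_tube {f₁ w : BinaryQuartic ℤ_[p]} {r : ℕ} (hr : 1 ≤ r) : MeasurableSet (tube f₁ w r) := by
  rw [tube_eq_iUnion hr]
  exact MeasurableSet.iUnion fun q ↦ measurableSet_smul_chartImage _ f₁ w r

/-! ## §5 `∫⁻_A N = [G : H_r] · μ_p(A ∩ W_r)` for invariant `A` -/

/-- The multiplicity as a finite sum of indicators. [folklore] -/
theorem mult_eq_sum (f₁ w : BinaryQuartic ℤ_[p]) (r : ℕ) (f : BinaryQuartic ℤ_[p]) :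
    (mult f₁ w r f : ℝ≥0∞) = ∑ q : G ⧸ levelSubgroup (p := p) r, (q.out • chartImage f₁ w r).indicator 1 f := by
  rw [mult, Nat.card_eq_fintype_card, Fintype.card_subtype, Finset.card_filter]
  push_cast
  refine Finset.sum_congr rfl fun q _ ↦ ?_
  by_cases h : f ∈ q.out • chartImage f₁ w r <;> simp [h]

/-- The multiplicity is a measurable function. [folklore] -/
theorem measurable_mult (f₁ w : BinaryQuartic ℤ_[p]) (r : ℕ) :
    Measurable fun f ↦ (mult f₁ w r f : ℝ≥0∞) := by
  have h : (fun f ↦ (mult f₁ w r f : ℝ≥0∞)) =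
      fun f ↦ ∑ q : G ⧸ levelSubgroup (p := p) r, (q.out • chartImage f₁ w r).indicator 1 f := by
    funext f; exact mult_eq_sum f₁ w r f
  rw [h]
  refine Finset.measurable_sum _ fun q _ ↦ ?_
  exact measurable_one.indicator (measurableSet_smul_chartImage _ f₁ w r)

/-- For an invariant set `A`: `t • (S ∩ A) = t • S ∩ A`. [folklore] -/
theorem smul_inter_eq_of_invariant (t : G) (S : Set (BinaryQuartic ℤ_[p])) {A : Set (BinaryQuartic ℤ_[p])}
    (hA : ∀ g : G, ∀ f, g • f ∈ A ↔ f ∈ A) : t • (S ∩ A) = t • S ∩ A := by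
  ext f
  simp only [Set.mem_smul_set, Set.mem_inter_iff]
  constructor
  · rintro ⟨x, ⟨hxS, hxA⟩, rfl⟩
    exact ⟨⟨x, hxS, rfl⟩, (hA t x).mpr hxA⟩
  · rintro ⟨⟨x, hxS, rfl⟩, hxA⟩
    exact ⟨x, ⟨hxS, (hA t x).mp hxA⟩, rfl⟩

/-- **`∫⁻_A N dμ_p = [G : H_r] · μ_p(W_r ∩ A)`** for every invariant measurable `A` (each of the
`[G : H_r]` translates `t • W_r` meets `A` in a set of measure `μ_p(W_r ∩ A)`, by invariance of
`A` and of `μ_p`). [folklore] -/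
theorem setLIntegral_mult {f₁ w : BinaryQuartic ℤ_[p]} {r : ℕ} {A : Set (BinaryQuartic ℤ_[p])}
    (hA : ∀ g : G, ∀ f, g • f ∈ A ↔ f ∈ A) :
    ∫⁻ f in A, (mult f₁ w r f : ℝ≥0∞) = (levelSubgroup (p := p) r).index * volume (chartImage f₁ w r ∩ A) := by
  simp_rw [mult_eq_sum]
  rw [lintegral_finsetSum _ fun q _ ↦ (measurable_one.indicator (measurableSet_smul_chartImage _ f₁ w r))]
  have hterm : ∀ q : G ⧸ levelSubgroup (p := p) r,
      ∫⁻ f in A, (q.out • chartImage f₁ w r).indicator 1 f = volume (chartImage f₁ w r ∩ A) := fun q ↦ by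
    rw [lintegral_indicator_one (measurableSet_smul_chartImage _ f₁ w r), Measure.restrict_apply
      (measurableSet_smul_chartImage _ f₁ w r), ← smul_inter_eq_of_invariant _ _ hA]
    exact padicInt_volume_image_glInt_smul _ _
  simp only [hterm, Finset.sum_const, Finset.card_univ, nsmul_eq_mul]
  rw [Subgroup.index, Nat.card_eq_fintype_card]


/-! ## §6 `μ_p(W_r ∩ A) = |det J_Ψ|_p · vol₅(chartBox ∩ Ψ̃⁻¹ A)`: change of variables for `Ψ` -/

/-- `|det J_Ψ|_p = |m|_p / |27|_p`. [folklore] -/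
theorem norm_det_jacOrbit (f₁ w : BinaryQuartic ℤ_[p]) :
    ‖(jacOrbit f₁ w).det‖ = ‖f₁.sliceJac w‖ / ‖(27 : ℤ_[p])‖ := by
  have h27 : ‖(27 : ℤ_[p])‖ ≠ 0 := norm_ne_zero_iff.mpr (by norm_num)
  rw [eq_div_iff h27, mul_comm, ← norm_mul, det_jacOrbit]

/-- `|m|_p ≤ |det J_Ψ|_p` (as `|27|_p ≤ 1`). [folklore] -/
theorem norm_sliceJac_le_norm_det_jacOrbit (f₁ w : BinaryQuartic ℤ_[p]) :
    ‖f₁.sliceJac w‖ ≤ ‖(jacOrbit f₁ w).det‖ := by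
  rw [← det_jacOrbit, norm_mul]
  exact mul_le_of_le_one_left (norm_nonneg _) (PadicInt.norm_le_one _)

/-- The orbit chart's pointwise map is `coeffs ∘ orbitChartForm`. [folklore] -/
theorem evalVec_orbitChart_eq (f₁ w : BinaryQuartic ℤ_[p]) :
    (fun x : Fin 5 → ℤ_[p] ↦ fun i ↦ MvPolynomial.eval x (orbitChart f₁ w i)) = coeffs ∘ orbitChartForm f₁ w := by
  funext x; exact (coeffs_orbitChartForm f₁ w x).symm

/-- **`μ_p(W_r ∩ A) = |det J_Ψ|_p · vol₅(chartBox r ∩ Ψ̃⁻¹ A)`** for measurable `A`, when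
`p⁻ʳ < |m|_p` (so that `Ψ` is injective on the box with constant `|det J_Ψ|`). [folklore] -/
theorem volume_chartImage_inter (f₁ w : BinaryQuartic ℤ_[p]) {r : ℕ} (hm : (p : ℝ) ^ (-(r : ℤ)) < ‖f₁.sliceJac w‖)
    {A : Set (BinaryQuartic ℤ_[p])} (hAm : MeasurableSet A) :
    volume (chartImage f₁ w r ∩ A) =
      (‖(jacOrbit f₁ w).det‖₊ : ℝ≥0∞) * volume (orbitChartForm f₁ w ⁻¹' A ∩ chartBox r) := by
  have hd : (Matrix.of fun i j ↦ MvPolynomial.eval chartCenter (pderiv j (orbitChart f₁ w i))).det ≠ 0 := by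
    rw [jacobian_orbitChart]
    intro h0
    have := norm_sliceJac_le_norm_det_jacOrbit f₁ w
    rw [h0, norm_zero] at this
    exact (lt_irrefl _ ((hm.trans_le this).trans_le' (by positivity))).elim
  have hrd : (p : ℝ) ^ (-(r : ℤ)) < ‖(Matrix.of fun i j ↦ MvPolynomial.eval chartCenter (pderiv j (orbitChart f₁ w i))).det‖ := by
    rw [jacobian_orbitChart]; exact hm.trans_le (norm_sliceJac_le_norm_det_jacOrbit f₁ w)
  have hP : MeasurableSet (orbitChartForm f₁ w ⁻¹' A) := hAm.preimage (continuous_orbitChartForm f₁ w).measurable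
  have key := Literature.MeasureTheory.Group.padicInt_pi_volume_image_inter_closedBall (orbitChart f₁ w) chartCenter hd
    (zpow_pos (by exact_mod_cast (Fact.out : p.Prime).pos) _) hrd hP
  rw [jacobian_orbitChart, evalVec_orbitChart_eq, Set.image_comp] at key
  rw [volume_eq_volume_image_coeffs, chartImage, ← Set.image_inter_preimage, inter_comm]
  exact key

/-! ## §7 `chartBox ∩ Ψ̃⁻¹ A = chartBox ∩ Φ⁻¹(ℤ_p³ × (I,J)(A ∩ S_r))` for invariant `A` -/

/-- The invariants of the orbit chart are the last two components of `Φ`. [folklore] -/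
theorem invPair_orbitChartForm (f₁ w : BinaryQuartic ℤ_[p]) (x : Fin 5 → ℤ_[p]) :
    invPair (orbitChartForm f₁ w x) =
      ((fun i ↦ MvPolynomial.eval x (invChart f₁ w i)) 3, (fun i ↦ MvPolynomial.eval x (invChart f₁ w i)) 4) := by
  rw [orbitChartForm_eq, eval_invChart, invPair]
  obtain ⟨hI, hJ⟩ := invariants_orbitChart f₁ w x
  simp [hI, hJ]

/-- **`chartBox ∩ Ψ̃⁻¹ A = chartBox ∩ Φ⁻¹{y : (y₃, y₄) ∈ (I,J)(A ∩ S_r)}`** for invariant `A`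
(`r ≥ 1`, `p⁻ʳ < |m|_p`): a point `Ψ̃(x) = k • s'` of `W_r` lies in `A` iff `s'` does, iff its
invariants lie in `(I,J)(A ∩ S_r)` (injectivity of `(I,J)` on the slice). [folklore] -/
theorem preimage_orbitChartForm_inter_chartBox (f₁ w : BinaryQuartic ℤ_[p]) {r : ℕ} (hr : 1 ≤ r)
    (hm : (p : ℝ) ^ (-(r : ℤ)) < ‖f₁.sliceJac w‖) {A : Set (BinaryQuartic ℤ_[p])}
    (hA : ∀ g : G, ∀ f, g • f ∈ A ↔ f ∈ A) :
    orbitChartForm f₁ w ⁻¹' A ∩ chartBox r =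
      (fun x ↦ fun i ↦ MvPolynomial.eval x (invChart f₁ w i)) ⁻¹'
          {y | (y 3, y 4) ∈ invPair '' (A ∩ slice f₁ w r)} ∩ chartBox r := by
  ext x
  simp only [mem_inter_iff, mem_preimage, mem_setOf_eq, and_congr_left_iff]
  intro hx
  obtain ⟨k, hk, s', hs', heq⟩ := exists_mem_slice_of_mem_chartBox (f₁ := f₁) (w := w) hr hx
  have hinv : invPair s' = ((fun i ↦ MvPolynomial.eval x (invChart f₁ w i)) 3, (fun i ↦ MvPolynomial.eval x (invChart f₁ w i)) 4) := by
    rw [← invPair_orbitChartForm, heq, invPair_glInt_smul]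
  rw [← hinv, heq, hA]
  constructor
  · intro h; exact ⟨s', ⟨h, hs'⟩, rfl⟩
  · rintro ⟨s'', ⟨hs''A, hs''⟩, he⟩
    have : s'' = s' := invPair_injOn_slice f₁ w hm hs'' hs' he
    rwa [← this]

/-! ## §8 The linearised image of the box under `Φ` and its sections -/

/-- **Membership in `Φ(x₀) + J_Φ · B_r`**: `y` lies in the linearised image iff `|y₀|, |y₁|,
|y₂ − 1| ≤ p⁻ʳ` and `(y₃, y₄)` lies in the invariant box `B`. [folklore] -/
theorem mem_image_jacInv_iff' (f₁ w : BinaryQuartic ℤ_[p]) (r : ℕ) (y : Fin 5 → ℤ_[p]) :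
    y ∈ (fun z ↦ (fun i ↦ MvPolynomial.eval chartCenter (invChart f₁ w i)) + jacInv f₁ w *ᵥ z) ''
          closedBall (0 : Fin 5 → ℤ_[p]) ((p : ℝ) ^ (-(r : ℤ))) ↔
      ‖y 0‖ ≤ (p : ℝ) ^ (-(r : ℤ)) ∧ ‖y 1‖ ≤ (p : ℝ) ^ (-(r : ℤ)) ∧ ‖y 2 - 1‖ ≤ (p : ℝ) ^ (-(r : ℤ)) ∧
        (y 3, y 4) ∈ invBox f₁ w r := by
  have hp0 : (0 : ℝ) ≤ (p : ℝ) ^ (-(r : ℤ)) := by positivity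
  rw [eval_invChart_center]
  constructor
  · rintro ⟨z, hz, rfl⟩
    rw [mem_closedBall, dist_zero_right, pi_norm_le_iff_of_nonneg hp0] at hz
    beta_reduce
    rw [jacInv_eq_mul_shear, ← Matrix.mulVec_mulVec, shear_mulVec, jacInv'_mulVec]
    simp only [Pi.add_apply, Matrix.cons_val_zero, Matrix.cons_val_one, Matrix.head_cons, Matrix.cons_val_two,
      Matrix.tail_cons, Matrix.cons_val_three, Matrix.cons_val_four, zero_add, add_sub_cancel_left]
    refine ⟨hz 0, hz 1, hz 2, ![2 * z 2 + z 3, z 4], ?_, ?_⟩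
    · rw [pi_norm_le_iff_of_nonneg hp0]
      intro i
      fin_cases i
      · show ‖2 * z 2 + z 3‖ ≤ _
        refine (PadicInt.nonarchimedean _ _).trans (max_le ?_ (hz 3))
        rw [norm_mul]
        exact (mul_le_of_le_one_left (norm_nonneg _) (PadicInt.norm_le_one _)).trans (hz 2)
      · simpa using hz 4
    · simp [invBlock, Matrix.mulVec, dotProduct, Fin.sum_univ_two]
  · rintro ⟨h0, h1, h2, z', hz', hIJ⟩
    rw [pi_norm_le_iff_of_nonneg hp0] at hz'
    simp only [Prod.mk.injEq] at hIJ
    obtain ⟨h3, h4⟩ := hIJ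
    refine ⟨![y 0, y 1, y 2 - 1, z' 0 - 2 * (y 2 - 1), z' 1], ?_, ?_⟩
    · rw [mem_closedBall, dist_zero_right, pi_norm_le_iff_of_nonneg hp0]
      intro i
      fin_cases i
      · simpa using h0
      · simpa using h1
      · simpa using h2
      · show ‖z' 0 - 2 * (y 2 - 1)‖ ≤ _
        rw [sub_eq_add_neg (z' 0)]
        refine (PadicInt.nonarchimedean _ _).trans (max_le (hz' 0) ?_)
        rw [norm_neg, norm_mul]
        exact (mul_le_of_le_one_left (norm_nonneg _) (PadicInt.norm_le_one _)).trans h2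
      · simpa using hz' 1
    · beta_reduce
      rw [jacInv_eq_mul_shear, ← Matrix.mulVec_mulVec, shear_mulVec, jacInv'_mulVec]
      funext i
      fin_cases i
      · simp
      · simp
      · simp
      · simp only [Pi.add_apply]
        simp [invBlock, Matrix.mulVec, dotProduct, Fin.sum_univ_two] at h3 ⊢
        exact h3.symm
      · simp only [Pi.add_apply]
        simp [invBlock, Matrix.mulVec, dotProduct, Fin.sum_univ_two] at h4 ⊢
        exact h4.symm

/-- The intersection of the linearised image with a cylinder `{(y₃,y₄) ∈ T}`, `T ⊆ B`, is the
product set `{|y₀|,|y₁|,|y₂−1| ≤ p⁻ʳ} × T`. [folklore] -/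
theorem cylinder_inter_image_jacInv (f₁ w : BinaryQuartic ℤ_[p]) (r : ℕ) {T : Set (ℤ_[p] × ℤ_[p])}
    (hT : T ⊆ invBox f₁ w r) :
    {y : Fin 5 → ℤ_[p] | (y 3, y 4) ∈ T} ∩
        (fun z ↦ (fun i ↦ MvPolynomial.eval chartCenter (invChart f₁ w i)) + jacInv f₁ w *ᵥ z) ''
          closedBall (0 : Fin 5 → ℤ_[p]) ((p : ℝ) ^ (-(r : ℤ))) =
      {y | ‖y 0‖ ≤ (p : ℝ) ^ (-(r : ℤ)) ∧ ‖y 1‖ ≤ (p : ℝ) ^ (-(r : ℤ)) ∧ ‖y 2 - 1‖ ≤ (p : ℝ) ^ (-(r : ℤ)) ∧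
        (y 3, y 4) ∈ T} := by
  ext y
  rw [mem_inter_iff, mem_image_jacInv_iff']
  simp only [mem_setOf_eq]
  constructor
  · rintro ⟨hyT, h0, h1, h2, -⟩; exact ⟨h0, h1, h2, hyT⟩
  · rintro ⟨h0, h1, h2, hyT⟩; exact ⟨hyT, h0, h1, h2, hT hyT⟩

/-! ## §9 The volume of the cylinder: `ℤ_p⁵ = ℤ_p³ × ℤ_p²` -/

/-- The coordinate splitting `Fin 3 ⊕ Fin 2 ≃ Fin 5`. [folklore] -/
def splitIndex : Fin 3 ⊕ Fin 2 ≃ Fin 5 := finSumFinEquiv (m := 3) (n := 2)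

/-- `splitIndex (inl i) = i`. [folklore] -/
@[simp] theorem splitIndex_inl (i : Fin 3) : splitIndex (Sum.inl i) = Fin.castAdd 2 i :=
  finSumFinEquiv_apply_left i

/-- `splitIndex (inr j) = 3 + j`. [folklore] -/
@[simp] theorem splitIndex_inr (j : Fin 2) : splitIndex (Sum.inr j) = Fin.natAdd 3 j :=
  finSumFinEquiv_apply_right j

/-- The measurable splitting `ℤ_p⁵ ≃ᵐ ℤ_p³ × ℤ_p²` into the first three and last two coordinates.
[folklore] -/
def splitEquiv : (Fin 5 → ℤ_[p]) ≃ᵐ (Fin 3 → ℤ_[p]) × (Fin 2 → ℤ_[p]) :=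
  (MeasurableEquiv.piCongrLeft (fun _ : Fin 5 ↦ ℤ_[p]) splitIndex).symm.trans
    (MeasurableEquiv.sumPiEquivProdPi fun _ : Fin 3 ⊕ Fin 2 ↦ ℤ_[p])

/-- The splitting is measure preserving. [folklore] -/
theorem measurePreserving_split : MeasurePreserving (splitEquiv (p := p)) volume volume :=
  (MeasurePreserving.symm _ (volume_measurePreserving_piCongrLeft (fun _ : Fin 5 ↦ ℤ_[p]) splitIndex)).trans
    (volume_measurePreserving_sumPiEquivProdPi fun _ : Fin 3 ⊕ Fin 2 ↦ ℤ_[p])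

/-- The splitting map in coordinates: `y ↦ ((y₀, y₁, y₂), (y₃, y₄))`. [folklore] -/
theorem split_apply (y : Fin 5 → ℤ_[p]) :
    splitEquiv y = (fun i : Fin 3 ↦ y (Fin.castAdd 2 i), fun j : Fin 2 ↦ y (Fin.natAdd 3 j)) := by
  have hsymm : ∀ t : Fin 3 ⊕ Fin 2,
      (MeasurableEquiv.piCongrLeft (fun _ : Fin 5 ↦ ℤ_[p]) splitIndex).symm y t = y (splitIndex t) := fun t ↦ by
    show (Equiv.piCongrLeft (fun _ : Fin 5 ↦ ℤ_[p]) splitIndex).symm y t = _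
    simp only [Equiv.piCongrLeft_symm_apply]
  rw [splitEquiv, MeasurableEquiv.coe_trans, Function.comp_apply, MeasurableEquiv.coe_sumPiEquivProdPi]
  refine Prod.ext (funext fun i ↦ ?_) (funext fun j ↦ ?_)
  · show (MeasurableEquiv.piCongrLeft (fun _ : Fin 5 ↦ ℤ_[p]) splitIndex).symm y (Sum.inl i) = _
    rw [hsymm, splitIndex_inl]
  · show (MeasurableEquiv.piCongrLeft (fun _ : Fin 5 ↦ ℤ_[p]) splitIndex).symm y (Sum.inr j) = _
    rw [hsymm, splitIndex_inr]

/-- **The volume of the cylinder** `{|y₀|,|y₁|,|y₂−1| ≤ p⁻ʳ, (y₃,y₄) ∈ T}` is `p^{−3r} · vol₂(T)`.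
[folklore] -/
theorem volume_cylinder (r : ℕ) (T : Set (ℤ_[p] × ℤ_[p])) :
    volume {y : Fin 5 → ℤ_[p] | ‖y 0‖ ≤ (p : ℝ) ^ (-(r : ℤ)) ∧ ‖y 1‖ ≤ (p : ℝ) ^ (-(r : ℤ)) ∧
        ‖y 2 - 1‖ ≤ (p : ℝ) ^ (-(r : ℤ)) ∧ (y 3, y 4) ∈ T} =
      (((p : ℝ≥0∞) ^ r)⁻¹) ^ 3 * volume T := by
  set box₃ : Set (Fin 3 → ℤ_[p]) := closedBall ![0, 0, 1] ((p : ℝ) ^ (-(r : ℤ))) with hbox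
  set T₂ : Set (Fin 2 → ℤ_[p]) := MeasurableEquiv.finTwoArrow ⁻¹' T with hT₂
  have hp0 : (0 : ℝ) ≤ (p : ℝ) ^ (-(r : ℤ)) := by positivity
  have hb : ∀ y : Fin 5 → ℤ_[p], (fun i : Fin 3 ↦ y (Fin.castAdd 2 i)) ∈ box₃ ↔
      ‖y 0‖ ≤ (p : ℝ) ^ (-(r : ℤ)) ∧ ‖y 1‖ ≤ (p : ℝ) ^ (-(r : ℤ)) ∧ ‖y 2 - 1‖ ≤ (p : ℝ) ^ (-(r : ℤ)) := fun y ↦ by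
    rw [hbox, mem_closedBall, dist_eq_norm, pi_norm_le_iff_of_nonneg hp0]
    constructor
    · intro h
      refine ⟨?_, ?_, ?_⟩
      · simpa using h 0
      · have := h 1
        change ‖y 1 - (![0, 0, 1] : Fin 3 → ℤ_[p]) 1‖ ≤ _ at this
        simpa using this
      · have := h 2
        change ‖y 2 - (![0, 0, 1] : Fin 3 → ℤ_[p]) 2‖ ≤ _ at this
        simpa using this
    · rintro ⟨h0, h1, h2⟩ i
      fin_cases i
      · simpa using h0
      · change ‖y 1 - (![0, 0, 1] : Fin 3 → ℤ_[p]) 1‖ ≤ _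
        simpa using h1
      · change ‖y 2 - (![0, 0, 1] : Fin 3 → ℤ_[p]) 2‖ ≤ _
        simpa using h2
  have ht : ∀ y : Fin 5 → ℤ_[p], (fun j : Fin 2 ↦ y (Fin.natAdd 3 j)) ∈ T₂ ↔ (y 3, y 4) ∈ T := fun y ↦ by
    rw [hT₂, mem_preimage, MeasurableEquiv.finTwoArrow_apply]
    rfl
  have hset : {y : Fin 5 → ℤ_[p] | ‖y 0‖ ≤ (p : ℝ) ^ (-(r : ℤ)) ∧ ‖y 1‖ ≤ (p : ℝ) ^ (-(r : ℤ)) ∧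
        ‖y 2 - 1‖ ≤ (p : ℝ) ^ (-(r : ℤ)) ∧ (y 3, y 4) ∈ T} = splitEquiv ⁻¹' (box₃ ×ˢ T₂) := by
    ext y
    rw [mem_preimage, split_apply, mem_prod, hb, ht]
    simp only [mem_setOf_eq, and_assoc]
  rw [hset, measurePreserving_split.measure_preimage_equiv, Measure.volume_eq_prod, Measure.prod_prod]
  congr 1
  · rw [hbox, volume_pi_closedBall _ hp0]
    simp only [Literature.MeasureTheory.Group.padicInt_volume_closedBall, Finset.prod_const, Finset.card_univ,
      Fintype.card_fin]
  · rw [hT₂]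
    exact (volume_preserving_finTwoArrow ℤ_[p]).measure_preimage_equiv _

/-! ## §10 `|m|_p · vol₅(chartBox ∩ Φ⁻¹ C_T) = p^{−3r} vol₂(T)`: change of variables for `Φ` -/

/-- **`|m|_p · vol₅(chartBox r ∩ Φ⁻¹{(y₃,y₄) ∈ T}) = p^{−3r} · vol₂(T)`** for measurable `T ⊆ B`
and `p⁻ʳ < |m|_p`. [folklore] -/
theorem norm_sliceJac_mul_volume_preimage_invChart (f₁ w : BinaryQuartic ℤ_[p]) {r : ℕ}
    (hm : (p : ℝ) ^ (-(r : ℤ)) < ‖f₁.sliceJac w‖) {T : Set (ℤ_[p] × ℤ_[p])} (hT : MeasurableSet T)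
    (hTB : T ⊆ invBox f₁ w r) :
    (‖f₁.sliceJac w‖₊ : ℝ≥0∞) *
        volume ((fun x ↦ fun i ↦ MvPolynomial.eval x (invChart f₁ w i)) ⁻¹' {y | (y 3, y 4) ∈ T} ∩ chartBox r) =
      (((p : ℝ≥0∞) ^ r)⁻¹) ^ 3 * volume T := by
  have hmne : f₁.sliceJac w ≠ 0 := by
    intro h0; rw [h0, norm_zero] at hm; exact (lt_irrefl _ (hm.trans_le' (by positivity))).elim
  have hd : (Matrix.of fun i j ↦ MvPolynomial.eval chartCenter (pderiv j (invChart f₁ w i))).det ≠ 0 := by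
    rw [det_jacobian_invChart]; exact hmne
  have hrd : (p : ℝ) ^ (-(r : ℤ)) < ‖(Matrix.of fun i j ↦ MvPolynomial.eval chartCenter (pderiv j (invChart f₁ w i))).det‖ := by
    rw [det_jacobian_invChart]; exact hm
  have hC : MeasurableSet {y : Fin 5 → ℤ_[p] | (y 3, y 4) ∈ T} :=
    hT.preimage (by fun_prop : Measurable fun y : Fin 5 → ℤ_[p] ↦ (y 3, y 4))
  have hP : MeasurableSet ((fun x ↦ fun i ↦ MvPolynomial.eval x (invChart f₁ w i)) ⁻¹' {y | (y 3, y 4) ∈ T}) :=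
    hC.preimage (Literature.MeasureTheory.Group.continuous_evalVec _).measurable
  have key := Literature.MeasureTheory.Group.padicInt_pi_volume_image_inter_closedBall (invChart f₁ w) chartCenter hd
    (zpow_pos (by exact_mod_cast (Fact.out : p.Prime).pos) _) hrd hP
  rw [det_jacobian_invChart, Set.image_preimage_inter,
    Literature.RingTheory.HenselLemma.image_eval_closedBall_eq (invChart f₁ w) chartCenter hd (by positivity) hrd,
    jacobian_invChart, cylinder_inter_image_jacInv f₁ w r hTB, volume_cylinder r T] at key
  exact key.symm


/-! ## §11 Measurability of `(I, J)(A ∩ S_r)` (Lusin–Souslin) -/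

/-- `V_{ℤ_p}` is a Polish space (the coefficient map is a closed embedding onto `ℤ_p⁵`). [folklore] -/
instance instPolishSpace : PolishSpace (BinaryQuartic ℤ_[p]) := by
  have hrange : Set.range (coeffs : BinaryQuartic ℤ_[p] → Fin 5 → ℤ_[p]) = univ :=
    Set.range_eq_univ.mpr (equivFin5 (R := ℤ_[p])).surjective
  have h : Topology.IsClosedEmbedding (coeffs : BinaryQuartic ℤ_[p] → Fin 5 → ℤ_[p]) :=
    ⟨⟨isInducing_coeffs, coeffs_injective⟩, by rw [hrange]; exact isClosed_univ⟩
  exact h.polishSpace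

/-- The slice is the continuous image of a product of two balls. [folklore] -/
theorem slice_eq_image (f₁ w : BinaryQuartic ℤ_[p]) (r : ℕ) :
    slice f₁ w r = (fun uv : ℤ_[p] × ℤ_[p] ↦ (1 + uv.1) • f₁ + uv.2 • w) ''
      (closedBall (0 : ℤ_[p]) ((p : ℝ) ^ (-(r : ℤ))) ×ˢ closedBall (0 : ℤ_[p]) ((p : ℝ) ^ (-(r : ℤ)))) := by
  ext s
  simp only [slice, mem_setOf_eq, mem_image, mem_prod, mem_closedBall, dist_zero_right, Prod.exists]
  constructor
  · rintro ⟨u, v, hu, hv, rfl⟩; exact ⟨u, v, ⟨hu, hv⟩, rfl⟩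
  · rintro ⟨u, v, ⟨hu, hv⟩, rfl⟩; exact ⟨u, v, hu, hv, rfl⟩

/-- **The slice is compact**, hence measurable. [folklore] -/
theorem isCompact_slice (f₁ w : BinaryQuartic ℤ_[p]) (r : ℕ) : IsCompact (slice f₁ w r) := by
  rw [slice_eq_image]
  refine ((isCompact_closedBall _ _).prod (isCompact_closedBall _ _)).image ?_
  refine (continuous_iff _).mpr ⟨?_, ?_, ?_, ?_, ?_⟩ <;>
    simp only [add_a, add_b, add_c, add_d, add_e, smul_a, smul_b, smul_c, smul_d, smul_e] <;> fun_prop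

/-- The slice is measurable. [folklore] -/
theorem measurableSet_slice (f₁ w : BinaryQuartic ℤ_[p]) (r : ℕ) : MeasurableSet (slice f₁ w r) :=
  (isCompact_slice f₁ w r).isClosed.measurableSet

/-- **`(I, J)(A ∩ S_r)` is measurable** for measurable `A` when `(I, J)` is injective on the slice
(Lusin–Souslin). [folklore] -/
theorem measurableSet_invPair_image (f₁ w : BinaryQuartic ℤ_[p]) {r : ℕ}
    (hm : (p : ℝ) ^ (-(r : ℤ)) < ‖f₁.sliceJac w‖) {A : Set (BinaryQuartic ℤ_[p])} (hAm : MeasurableSet A) :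
    MeasurableSet (invPair '' (A ∩ slice f₁ w r)) :=
  (hAm.inter (measurableSet_slice f₁ w r)).image_of_continuousOn_injOn continuous_invPair.continuousOn
    ((invPair_injOn_slice f₁ w hm).mono inter_subset_right)

/-! ## §12 The tube theorem -/

/-- The constants: `[G : H_r] · p^{−3r} = (p² − 1)/p²` (`= Vol(PGL₂(ℤ_p)) = 1 − p⁻²`). [folklore] -/
theorem index_mul_inv_pow_cube {r : ℕ} (hr : 1 ≤ r) :
    ((levelSubgroup (p := p) r).index : ℝ≥0∞) * (((p : ℝ≥0∞) ^ r)⁻¹) ^ 3 =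
      ((p ^ 2 - 1 : ℕ) : ℝ≥0∞) / (p : ℝ≥0∞) ^ 2 := by
  rw [index_levelSubgroup hr]
  have hp0 : (p : ℝ≥0∞) ≠ 0 := by exact_mod_cast (Fact.out : p.Prime).ne_zero
  have hpt : (p : ℝ≥0∞) ≠ ⊤ := ENNReal.natCast_ne_top p
  have hk0 : ((p : ℝ≥0∞) ^ (3 * r - 2)) ≠ 0 := pow_ne_zero _ hp0
  have hkt : ((p : ℝ≥0∞) ^ (3 * r - 2)) ≠ ⊤ := ENNReal.pow_ne_top hpt
  have h3r : ((p : ℝ≥0∞) ^ r) ^ 3 = (p : ℝ≥0∞) ^ (3 * r - 2) * (p : ℝ≥0∞) ^ 2 := by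
    rw [← pow_mul, ← pow_add]; congr 1; omega
  push_cast
  rw [← ENNReal.inv_pow, h3r, ENNReal.mul_inv (Or.inl hk0) (Or.inl hkt), div_eq_mul_inv]
  calc (p : ℝ≥0∞) ^ (3 * r - 2) * ((p : ℝ≥0∞) ^ 2 - 1) * (((p : ℝ≥0∞) ^ (3 * r - 2))⁻¹ * ((p : ℝ≥0∞) ^ 2)⁻¹)
      = ((p : ℝ≥0∞) ^ (3 * r - 2) * ((p : ℝ≥0∞) ^ (3 * r - 2))⁻¹) * (((p : ℝ≥0∞) ^ 2 - 1) * ((p : ℝ≥0∞) ^ 2)⁻¹) := by ring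
    _ = ((p : ℝ≥0∞) ^ 2 - 1) * ((p : ℝ≥0∞) ^ 2)⁻¹ := by rw [ENNReal.mul_inv_cancel hk0 hkt, one_mul]
    _ = _ := by congr 1

/-- `‖det J_Ψ‖₊ = ‖m‖₊ · ‖27‖₊⁻¹`. [folklore] -/
theorem nnnorm_det_jacOrbit (f₁ w : BinaryQuartic ℤ_[p]) :
    (‖(jacOrbit f₁ w).det‖₊ : ℝ≥0∞) = (‖f₁.sliceJac w‖₊ : ℝ≥0∞) * (‖(27 : ℤ_[p])‖₊ : ℝ≥0∞)⁻¹ := by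
  have h27 : ‖(27 : ℤ_[p])‖₊ ≠ 0 := nnnorm_ne_zero_iff.mpr (by norm_num)
  rw [← ENNReal.coe_inv h27, ← ENNReal.coe_mul, ENNReal.coe_inj]
  apply NNReal.eq
  push_cast
  rw [norm_det_jacOrbit, div_eq_mul_inv]

/-- **The tube theorem** (Bhargava–Shankar's `p`-adic change of measure, Props. 3.11–3.12 of the
published version, on one orbit tube). Let `f₁ ∈ V_{ℤ_p}`, `w` a transverse direction, `r ≥ 1`
with `pʳ ∤ 2`, `p⁻ʳ < |m(f₁,w)|_p` and `Δ ≠ 0` on the slice `S_r`. Then for every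
`GL₂(ℤ_p)`-invariant measurable `A ⊆ U_r`,

  `∫⁻_{A} #Aut_{ℤ_p}(f) dμ_p(f) = (1 − p⁻²) · |1/27|_p · vol₂((I, J)(A ∩ S_r))`,

the fibres of `(I, J)` in `U_r` being single orbits, so that `(I,J)(A ∩ S_r)` is the set of
invariants whose orbit lies in `A`. [cite: BhargavaShankarAnnals2015, Prop. 5.12 proof (|2/27|_p Vol(PGL₂(ℤ_p)) Σ 1/#Aut; arXiv:1006.1002v2 numbering)] -/
theorem setLIntegral_autCard_tube (f₁ w : BinaryQuartic ℤ_[p]) {r : ℕ} (hr : 1 ≤ r) (h2 : ¬ (p : ℤ_[p]) ^ r ∣ 2)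
    (hm : (p : ℝ) ^ (-(r : ℤ)) < ‖f₁.sliceJac w‖) (hΔ : ∀ s ∈ slice f₁ w r, s.disc ≠ 0)
    {A : Set (BinaryQuartic ℤ_[p])} (hAm : MeasurableSet A) (hA : ∀ g : G, ∀ f, g • f ∈ A ↔ f ∈ A)
    (hAU : A ⊆ tube f₁ w r) :
    ∫⁻ f in A, (autCard f : ℝ≥0∞) =
      ((p ^ 2 - 1 : ℕ) : ℝ≥0∞) / (p : ℝ≥0∞) ^ 2 * (‖(27 : ℤ_[p])‖₊ : ℝ≥0∞)⁻¹ * volume (invPair '' (A ∩ slice f₁ w r)) := by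
  set T := invPair '' (A ∩ slice f₁ w r) with hTdef
  have hT : MeasurableSet T := measurableSet_invPair_image f₁ w hm hAm
  have hTB : T ⊆ invBox f₁ w r := by
    rw [hTdef, ← invPair_image_slice f₁ w hm]; exact image_mono inter_subset_right
  -- Step 1: `autCard = mult` on `A ⊆ U_r`
  have h1 : ∫⁻ f in A, (autCard f : ℝ≥0∞) = ∫⁻ f in A, (mult f₁ w r f : ℝ≥0∞) := by
    refine setLIntegral_congr_fun hAm ?_
    intro f hf
    show (autCard f : ℝ≥0∞) = (mult f₁ w r f : ℝ≥0∞)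
    rw [mult_eq_autCard hr h2 hm hΔ (hAU hf)]
  -- Step 2: unfolding and `Ψ`
  rw [h1, setLIntegral_mult hA, volume_chartImage_inter f₁ w hm hAm, preimage_orbitChartForm_inter_chartBox f₁ w hr hm hA,
    nnnorm_det_jacOrbit]
  -- Step 3: `Φ`
  have h3 := norm_sliceJac_mul_volume_preimage_invChart f₁ w hm hT hTB
  set X := volume ((fun x ↦ fun i ↦ MvPolynomial.eval x (invChart f₁ w i)) ⁻¹' {y | (y 3, y 4) ∈ T} ∩ chartBox r) with hX
  -- Step 4: constants
  have hconst := index_mul_inv_pow_cube (p := p) hr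
  calc ((levelSubgroup (p := p) r).index : ℝ≥0∞) * ((‖f₁.sliceJac w‖₊ : ℝ≥0∞) * (‖(27 : ℤ_[p])‖₊ : ℝ≥0∞)⁻¹ * X)
      = (‖(27 : ℤ_[p])‖₊ : ℝ≥0∞)⁻¹ * (((levelSubgroup (p := p) r).index : ℝ≥0∞) * ((‖f₁.sliceJac w‖₊ : ℝ≥0∞) * X)) := by ring
    _ = (‖(27 : ℤ_[p])‖₊ : ℝ≥0∞)⁻¹ * (((levelSubgroup (p := p) r).index : ℝ≥0∞) * ((((p : ℝ≥0∞) ^ r)⁻¹) ^ 3 * volume T)) := by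
        rw [h3]
    _ = (((levelSubgroup (p := p) r).index : ℝ≥0∞) * (((p : ℝ≥0∞) ^ r)⁻¹) ^ 3) * (‖(27 : ℤ_[p])‖₊ : ℝ≥0∞)⁻¹ * volume T := by
        ring
    _ = _ := by rw [hconst]

end BinaryQuartic

end Literature.NumberTheory.EllipticCurves

end
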